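import Mathlib
import HarnessLib
import Summits.ValiantsHypothesis.Statement

/-!
# SymmetryDial — the natural module of `GL_e(𝔽₂)` is simple with trivial endomorphisms (rung R-simple toward A₁)

Decomposition workshop decomp-valiant, cycle 1 (VALIANT), lens 1, generation 4.  LADDER-Valiant rung 0: nothing
here bears on VP ≠ VNP directly.  Helper theorems toward route item `stmt-ValiantsHypothesis-23710`
(`AffineSupportTheorem` ⟺ `LinearSupportGL`, see `Theorems/SymmetryDialAffineReduction`, whose `V₂`/`GL₂` are
reducibly defeq to the local abbrevs below, so every theorem here applies verbatim there): the module-theoretic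
input (M1) of the «ParabolicCore» line — the radical of a parabolic core is, modulo a bounded central piece, a sum
of copies of the natural module `N = 𝔽₂^e` of `GL_e(𝔽₂)` and its dual, and the descent step needs `N` SIMPLE with
`End_{GL}(N) = 𝔽₂`.  Proved here from first principles (transvections `x ↦ x + φ(x)·a`):

* `exists_gl_apply_eq`   — `GL_e(𝔽₂)` is transitive on non-zero vectors;
* `natural_irreducible`  — a `GL_e(𝔽₂)`-invariant subspace of `𝔽₂^e` is `⊥` or `⊤`;
* `natural_endomorphism_trivial` — a linear endomorphism commuting with `GL_e(𝔽₂)` is `0` or `id`;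
* `fixed_vector_eq_zero` — for `e ≥ 2` the only `GL_e(𝔽₂)`-fixed vector is `0`;
* `invariant_bilinForm_eq_zero` — for `e ≥ 3` there is no non-zero `GL_e(𝔽₂)`-invariant bilinear form on `𝔽₂^e`
  (so `N ≇ N^*`; at `e = 2` the determinant pairing is one).
-/

set_option linter.dupNamespace false

namespace Summit.ValiantsHypothesis.ValiantsHypothesis.Theorems.SymmetryDialNaturalModule

/-- `𝔽₂^d` as a `ZMod 2`-module (reducibly defeq to `SymmetryDialAffineReduction.V₂`; declared locally so that this
file does not sit in the Theses cone of the route file). -/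
abbrev V₂ (d : ℕ) : Type := Fin d → ZMod 2

/-- The honest general linear group `GL_d(𝔽₂)` as linear automorphisms of `𝔽₂^d` (reducibly defeq to
`SymmetryDialAffineReduction.GL₂`). -/
abbrev GL₂ (d : ℕ) : Type := V₂ d ≃ₗ[ZMod 2] V₂ d

/-- In `ZMod 2` a non-zero element is `1`. -/
private theorem zmod2_eq_one_of_ne_zero (x : ZMod 2) (hx : x ≠ 0) : x = 1 := by
  revert x; decide

/-- In `ZMod 2` every element is `0` or `1`. -/
private theorem zmod2_cases (x : ZMod 2) : x = 0 ∨ x = 1 := by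
  revert x; decide

/-- `x + x = 0` in `𝔽₂^e`. -/
theorem add_self {e : ℕ} (x : V₂ e) : x + x = 0 := by
  funext i
  exact CharTwo.add_self_eq_zero (x i)

/-- In `𝔽₂^e`, `u + v = 0` forces `u = v`. -/
theorem eq_of_add_eq_zero {e : ℕ} {u v : V₂ e} (h : u + v = 0) : u = v := by
  have : u = u + (v + v) := by rw [add_self, add_zero]
  rw [this, ← add_assoc, h, zero_add]

/-- A non-zero vector is detected by some linear functional (with value `1`). -/
theorem exists_dual_eq_one {e : ℕ} {v : V₂ e} (hv : v ≠ 0) :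
    ∃ φ : Module.Dual (ZMod 2) (V₂ e), φ v = 1 := by
  by_contra hcon
  push Not at hcon
  apply hv
  refine (Module.forall_dual_apply_eq_zero_iff (ZMod 2) v).1 fun φ => ?_
  by_contra hφ
  exact hcon φ (zmod2_eq_one_of_ne_zero _ hφ)

/-- Two non-zero vectors are simultaneously sent to `1` by some linear functional. -/
theorem exists_dual_eq_one_one {e : ℕ} {v w : V₂ e} (hv : v ≠ 0) (hw : w ≠ 0) :
    ∃ φ : Module.Dual (ZMod 2) (V₂ e), φ v = 1 ∧ φ w = 1 := by
  obtain ⟨φ₁, h₁⟩ := exists_dual_eq_one hv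
  rcases zmod2_cases (φ₁ w) with h₁w | h₁w
  · obtain ⟨φ₂, h₂⟩ := exists_dual_eq_one hw
    rcases zmod2_cases (φ₂ v) with h₂v | h₂v
    · refine ⟨φ₁ + φ₂, ?_, ?_⟩
      · rw [LinearMap.add_apply, h₁, h₂v, add_zero]
      · rw [LinearMap.add_apply, h₁w, h₂, zero_add]
    · exact ⟨φ₂, h₂v, h₂⟩
  · exact ⟨φ₁, h₁, h₁w⟩

/-- A vector `u ∉ {0, v}` is separated from `v` by a functional with `φ v = 0`, `φ u = 1`. -/
theorem exists_dual_zero_one {e : ℕ} {v u : V₂ e} (hu : u ≠ 0) (huv : u ≠ v) :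
    ∃ φ : Module.Dual (ZMod 2) (V₂ e), φ v = 0 ∧ φ u = 1 := by
  by_cases hv : v = 0
  · obtain ⟨φ, h⟩ := exists_dual_eq_one hu
    exact ⟨φ, by rw [hv, map_zero], h⟩
  obtain ⟨φ₁, h₁⟩ := exists_dual_eq_one hu
  rcases zmod2_cases (φ₁ v) with h₁v | h₁v
  · exact ⟨φ₁, h₁v, h₁⟩
  · have huv' : u + v ≠ 0 := fun h => huv (eq_of_add_eq_zero h)
    obtain ⟨φ₂, h₂⟩ := exists_dual_eq_one huv'
    rw [map_add] at h₂
    rcases zmod2_cases (φ₂ u) with h₂u | h₂u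
    · rw [h₂u, zero_add] at h₂
      refine ⟨φ₁ + φ₂, ?_, ?_⟩
      · rw [LinearMap.add_apply, h₁v, h₂]; decide
      · rw [LinearMap.add_apply, h₁, h₂u, add_zero]
    · rw [h₂u] at h₂
      have h₂v : φ₂ v = 0 := by
        rcases zmod2_cases (φ₂ v) with h | h
        · exact h
        · rw [h] at h₂; exact absurd h₂ (by decide)
      exact ⟨φ₂, h₂v, h₂u⟩

/-- The map `x ↦ x + φ(x)·a` squares to the identity when `φ a = 0`. -/
theorem transvection_aux {e : ℕ} (φ : Module.Dual (ZMod 2) (V₂ e)) (a : V₂ e) (h : φ a = 0) (x : V₂ e) :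
    (x + φ x • a) + φ (x + φ x • a) • a = x := by
  rw [map_add, map_smul, h, smul_eq_mul, mul_zero, add_zero, add_assoc, ← add_smul,
    CharTwo.add_self_eq_zero, zero_smul, add_zero]

/-- The transvection `x ↦ x + φ(x)·a` (for `φ a = 0`) as an element of `GL_e(𝔽₂)`. -/
def transvection {e : ℕ} (φ : Module.Dual (ZMod 2) (V₂ e)) (a : V₂ e) (h : φ a = 0) : GL₂ e :=
  LinearEquiv.ofLinear (LinearMap.id + φ.smulRight a) (LinearMap.id + φ.smulRight a)
    (LinearMap.ext fun x => by simpa using transvection_aux φ a h x)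
    (LinearMap.ext fun x => by simpa using transvection_aux φ a h x)

/-- `transvection φ a h` acts as `x ↦ x + φ(x)·a`. -/
@[simp] theorem transvection_apply {e : ℕ} (φ : Module.Dual (ZMod 2) (V₂ e)) (a : V₂ e) (h : φ a = 0)
    (x : V₂ e) : transvection φ a h x = x + φ x • a := rfl

/-- **`GL_e(𝔽₂)` is transitive on non-zero vectors.** -/
theorem exists_gl_apply_eq {e : ℕ} {v w : V₂ e} (hv : v ≠ 0) (hw : w ≠ 0) : ∃ g : GL₂ e, g v = w := by
  by_cases hvw : v = w
  · exact ⟨1, by rw [hvw]; rfl⟩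
  · obtain ⟨φ, hφv, hφw⟩ := exists_dual_eq_one_one hv hw
    have ha : φ (v + w) = 0 := by
      rw [map_add, hφv, hφw]; decide
    refine ⟨transvection φ (v + w) ha, ?_⟩
    rw [transvection_apply, hφv, one_smul, ← add_assoc, add_self, zero_add]

/-- **The natural module is simple:** a `GL_e(𝔽₂)`-invariant subspace of `𝔽₂^e` is `⊥` or `⊤`. -/
theorem natural_irreducible {e : ℕ} (N : Submodule (ZMod 2) (V₂ e))
    (hN : ∀ g : GL₂ e, ∀ x ∈ N, g x ∈ N) : N = ⊥ ∨ N = ⊤ := by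
  rcases eq_or_ne N ⊥ with h | h
  · exact Or.inl h
  · right
    obtain ⟨v, hvN, hv0⟩ := (Submodule.ne_bot_iff N).1 h
    rw [eq_top_iff]
    intro w _
    by_cases hw : w = 0
    · rw [hw]; exact N.zero_mem
    · obtain ⟨g, hg⟩ := exists_gl_apply_eq hv0 hw
      rw [← hg]; exact hN g v hvN

/-- A `GL_e(𝔽₂)`-equivariant endomorphism maps each non-zero vector to `0` or to itself. -/
theorem equivariant_apply_dichotomy {e : ℕ} (f : V₂ e →ₗ[ZMod 2] V₂ e)
    (hf : ∀ g : GL₂ e, ∀ x : V₂ e, f (g x) = g (f x)) {v : V₂ e} (hv : v ≠ 0) :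
    f v = 0 ∨ f v = v := by
  by_contra hcon
  push Not at hcon
  obtain ⟨hu0, huv⟩ := hcon
  obtain ⟨φ, hφv, hφu⟩ := exists_dual_zero_one hu0 huv
  have key := hf (transvection φ v hφv) v
  rw [transvection_apply, transvection_apply, hφv, zero_smul, add_zero, hφu, one_smul] at key
  -- key : f v = f v + v
  have h2 : f v + (f v + v) = f v + f v := by rw [← key]
  rw [← add_assoc, add_self, zero_add] at h2
  exact hv h2

/-- **`End_{GL_e(𝔽₂)}(𝔽₂^e) = 𝔽₂`:** an equivariant linear endomorphism is `0` or the identity. -/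
theorem natural_endomorphism_trivial {e : ℕ} (f : V₂ e →ₗ[ZMod 2] V₂ e)
    (hf : ∀ g : GL₂ e, ∀ x : V₂ e, f (g x) = g (f x)) : f = 0 ∨ f = LinearMap.id := by
  by_cases hall : ∀ v : V₂ e, v ≠ 0 → f v = 0
  · left
    refine LinearMap.ext fun v => ?_
    by_cases hv : v = 0
    · rw [hv, map_zero, LinearMap.zero_apply]
    · rw [LinearMap.zero_apply]; exact hall v hv
  · right
    push Not at hall
    obtain ⟨v, hv0, hfv⟩ := hall
    have hfv' : f v = v := (equivariant_apply_dichotomy f hf hv0).resolve_left hfv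
    refine LinearMap.ext fun w => ?_
    rw [LinearMap.id_apply]
    by_cases hw : w = 0
    · rw [hw, map_zero]
    rcases equivariant_apply_dichotomy f hf hw with hfw | hfw
    · -- f v = v, f w = 0: look at v + w
      exfalso
      have hvw : v + w ≠ 0 := by
        intro h
        have hvw' : v = w := eq_of_add_eq_zero h
        apply hv0
        calc v = f v := hfv'.symm
          _ = f w := by rw [hvw']
          _ = 0 := hfw
      rcases equivariant_apply_dichotomy f hf hvw with h | h
      · rw [map_add, hfv', hfw, add_zero] at h
        exact hv0 h
      · rw [map_add, hfv', hfw, add_zero] at h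
        -- h : v = v + w ⇒ w = 0
        apply hw
        have : v + (v + w) = v + v := by rw [← h]
        rwa [← add_assoc, add_self, zero_add] at this
    · exact hfw

/-- For `e ≥ 2` the only `GL_e(𝔽₂)`-fixed vector is `0` (no trivial submodule: `N^{GL} = 0`). -/
theorem fixed_vector_eq_zero {e : ℕ} (he : 2 ≤ e) {v : V₂ e} (hv : ∀ g : GL₂ e, g v = v) : v = 0 := by
  by_contra hv0
  -- every non-zero vector equals `v`, so `Pi.single i 1 = v` for two distinct indices
  have hall : ∀ w : V₂ e, w ≠ 0 → w = v := by
    intro w hw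
    obtain ⟨g, hg⟩ := exists_gl_apply_eq hv0 hw
    rw [← hg, hv g]
  let i₀ : Fin e := ⟨0, by omega⟩
  let i₁ : Fin e := ⟨1, by omega⟩
  have h0 : (Pi.single i₀ (1 : ZMod 2) : V₂ e) ≠ 0 := by
    intro h
    have := congr_fun h i₀
    simp [i₀] at this
  have h1 : (Pi.single i₁ (1 : ZMod 2) : V₂ e) ≠ 0 := by
    intro h
    have := congr_fun h i₁
    simp [i₁] at this
  have heq : (Pi.single i₀ (1 : ZMod 2) : V₂ e) = Pi.single i₁ 1 := by
    rw [hall _ h0, hall _ h1]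
  have := congr_fun heq i₀
  have hne : i₀ ≠ i₁ := by simp [i₀, i₁, Fin.ext_iff]
  rw [Pi.single_eq_same, Pi.single_eq_of_ne hne] at this
  exact absurd this (by decide)

/-- A vector outside the span of two others is separated from both by a linear functional. -/
theorem exists_dual_vanish_pair {e : ℕ} {x y u : V₂ e} (h : u ∉ Submodule.span (ZMod 2) ({x, y} : Set (V₂ e))) :
    ∃ φ : Module.Dual (ZMod 2) (V₂ e), φ x = 0 ∧ φ y = 0 ∧ φ u = 1 := by
  obtain ⟨φ, hφu, hmap⟩ := Submodule.exists_dual_map_eq_bot_of_notMem h inferInstance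
  have hker : ∀ z ∈ Submodule.span (ZMod 2) ({x, y} : Set (V₂ e)), φ z = 0 := by
    intro z hz
    have hz' : φ z ∈ (Submodule.span (ZMod 2) ({x, y} : Set (V₂ e))).map φ :=
      Submodule.mem_map_of_mem hz
    rw [hmap] at hz'
    exact (Submodule.mem_bot (R := ZMod 2)).1 hz'
  refine ⟨φ, hker x (Submodule.subset_span (by simp)), hker y (Submodule.subset_span (by simp)),
    zmod2_eq_one_of_ne_zero _ hφu⟩

/-- The stabiliser of a vector `x` in `GL_e(𝔽₂)` is transitive on the vectors outside `{0, x}`. -/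
theorem exists_gl_fix_apply_eq {e : ℕ} {x u u' : V₂ e} (hu : u ≠ 0) (hux : u ≠ x) (hu' : u' ≠ 0)
    (hu'x : u' ≠ x) : ∃ g : GL₂ e, g x = x ∧ g u = u' := by
  by_cases huu' : u = u'
  · exact ⟨1, rfl, by rw [huu']; rfl⟩
  · -- `u ∉ span {x, u + u'}` = {0, x, u + u', x + u + u'}
    have hnot : u ∉ Submodule.span (ZMod 2) ({x, u + u'} : Set (V₂ e)) := by
      intro hmem
      rw [Submodule.mem_span_pair] at hmem
      obtain ⟨a, b, hab⟩ := hmem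
      rcases zmod2_cases a with ha | ha <;> rcases zmod2_cases b with hb | hb <;> subst ha <;> subst hb
      · simp only [zero_smul, add_zero] at hab
        exact hu hab.symm
      · simp only [zero_smul, one_smul, zero_add] at hab
        -- u + u' = u ⇒ u' = 0
        apply hu'
        have : u + (u + u') = u + u := by rw [hab]
        rwa [← add_assoc, add_self, zero_add] at this
      · simp only [one_smul, zero_smul, add_zero] at hab
        exact hux hab.symm
      · simp only [one_smul] at hab
        -- x + (u + u') = u ⇒ u' = x
        apply hu'x
        have h2 : x + (u + u') + (x + u) = u + (x + u) := by rw [hab]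
        have h3 : x + (u + u') + (x + u) = u' := by
          calc x + (u + u') + (x + u) = (x + x) + (u + u) + u' := by abel
            _ = u' := by rw [add_self, add_self, zero_add, zero_add]
        have h4 : u + (x + u) = x := by
          calc u + (x + u) = (u + u) + x := by abel
            _ = x := by rw [add_self, zero_add]
        rw [h3, h4] at h2
        exact h2
    obtain ⟨φ, hφx, hφa, hφu⟩ := exists_dual_vanish_pair hnot
    refine ⟨transvection φ (u + u') hφa, ?_, ?_⟩
    · rw [transvection_apply, hφx, zero_smul, add_zero]
    · rw [transvection_apply, hφu, one_smul, ← add_assoc, add_self, zero_add]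

/-- **`N ≇ N*` for `e ≥ 3`:** the natural module of `GL_e(𝔽₂)` carries no non-zero invariant bilinear form
(so it is not isomorphic to its dual as a `GL_e(𝔽₂)`-module). -/
theorem invariant_bilinForm_eq_zero {e : ℕ} (he : 3 ≤ e) (B : V₂ e →ₗ[ZMod 2] V₂ e →ₗ[ZMod 2] ZMod 2)
    (hB : ∀ g : GL₂ e, ∀ x y : V₂ e, B (g x) (g y) = B x y) : B = 0 := by
  -- Step 1: for `x ≠ 0`, `B x` is constant on the vectors outside `{0, x}`.
  have hconst : ∀ x u u' : V₂ e, u ≠ 0 → u ≠ x → u' ≠ 0 → u' ≠ x → B x u = B x u' := by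
    intro x u u' hu hux hu' hu'x
    obtain ⟨g, hgx, hgu⟩ := exists_gl_fix_apply_eq hu hux hu' hu'x
    rw [← hgu, ← hB g x u, hgx]
  -- Step 2: for `x ≠ 0` there are `u ∉ span{x}` and `u' ∉ span{x,u}` (dimension ≥ 3).
  have hfin : Module.finrank (ZMod 2) (V₂ e) = e := Module.finrank_fin_fun (ZMod 2)
  have hexists : ∀ s : Finset (V₂ e), s.card ≤ 2 →
      ∃ w : V₂ e, w ∉ Submodule.span (ZMod 2) (s : Set (V₂ e)) := by
    intro s hs
    by_contra hcon
    push Not at hcon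
    have htop : Submodule.span (ZMod 2) (s : Set (V₂ e)) = ⊤ :=
      eq_top_iff.2 fun w _ => hcon w
    have h1 : Module.finrank (ZMod 2) (Submodule.span (ZMod 2) (s : Set (V₂ e))) ≤ s.card :=
      finrank_span_finset_le_card s
    rw [htop, finrank_top, hfin] at h1
    omega
  -- Step 3: `B x = 0` for every `x`.
  refine LinearMap.ext fun x => LinearMap.ext fun y => ?_
  rw [LinearMap.zero_apply, LinearMap.zero_apply]
  by_cases hx : x = 0
  · rw [hx, map_zero, LinearMap.zero_apply]
  classical
  obtain ⟨u, hu⟩ := hexists {x} (by simp)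
  obtain ⟨u', hu'⟩ := hexists {x, u} (Finset.card_le_two)
  have hux : u ≠ x := fun h => hu (h ▸ Submodule.subset_span (by simp))
  have hu0 : u ≠ 0 := fun h => hu (h ▸ Submodule.zero_mem _)
  have hu'x : u' ≠ x := fun h => hu' (h ▸ Submodule.subset_span (by simp))
  have hu'0 : u' ≠ 0 := fun h => hu' (h ▸ Submodule.zero_mem _)
  have hu'u : u' ≠ u := fun h => hu' (h ▸ Submodule.subset_span (by simp))
  -- `u + u' ∉ {0, x}`
  have hs0 : u + u' ≠ 0 := fun h => hu'u (eq_of_add_eq_zero h).symm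
  have hsx : u + u' ≠ x := by
    intro h
    apply hu'
    have : u' = x + u := by
      calc u' = (u + u) + u' := by rw [add_self, zero_add]
        _ = u + (u + u') := by rw [add_assoc]
        _ = u + x := by rw [h]
        _ = x + u := add_comm _ _
    rw [this]
    exact Submodule.add_mem _ (Submodule.subset_span (by simp)) (Submodule.subset_span (by simp))
  -- the common value `c` satisfies `c = c + c`, hence `c = 0`
  set c := B x u with hc
  have hcu' : B x u' = c := (hconst x u u' hu0 hux hu'0 hu'x).symm
  have hcs : B x (u + u') = c := (hconst x u (u + u') hu0 hux hs0 hsx).symm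
  have hc0 : c = 0 := by
    rw [map_add, hcu', ← hc] at hcs
    -- hcs : c + c = c
    rcases zmod2_cases c with h | h
    · exact h
    · rw [h] at hcs; exact absurd hcs (by decide)
  -- every vector outside `{0, x}` gets value `0`; and `x = (x + u) + u`
  have hout : ∀ w : V₂ e, w ≠ 0 → w ≠ x → B x w = 0 := by
    intro w hw hwx
    rw [← hc0]
    exact (hconst x u w hu0 hux hw hwx).symm
  by_cases hy : y = 0
  · rw [hy, map_zero]
  by_cases hyx : y = x
  · have hxu0 : x + u ≠ 0 := fun h => hux (eq_of_add_eq_zero h).symm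
    have hxux : x + u ≠ x := by
      intro h
      apply hu0
      have : x + (x + u) = x + x := by rw [h]
      rwa [← add_assoc, add_self, zero_add] at this
    have : y = (x + u) + u := by rw [hyx, add_assoc, add_self, add_zero]
    rw [this, map_add, hout _ hxu0 hxux, hout _ hu0 hux, add_zero]
  · exact hout y hy hyx

end Summit.ValiantsHypothesis.ValiantsHypothesis.Theorems.SymmetryDialNaturalModule
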